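import Summits.QuantumFields.YangMills.Theorems.EquipartitionCriticalityEquipartitionPinsProbeTangentDefs
import Summits.QuantumFields.YangMills.Theorems.EquipartitionCriticalityEquipartitionPinsProbeTangentComb
import HarnessLib

/-!
# Comb-gauge Poincaré inequality on `ℤ⁴`

Crux `stmt-QuantumFields-8760` (`EquipartitionPinsProbe`), line `Sketch`, stub `stub_combPoincare` (TC2)
of the reshaped `stub_tangentCore`.

For a unitary-valued representation `ρ : G →* M_N(ℂ)` write `E(g) = N − Re tr ρ(g)` (the "energy" of a
group element; `E(g) = ½‖ρ(g) − 1‖_F²`). For every edge `e` of `ℤ⁴` there are a finite set `S` of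
plaquettes and a constant `C ≥ 0` such that, for EVERY configuration `U`, the energy of the
gauge-fixed link variable `Ũ_e = axialFix U e` (complete axial / comb gauge of `…TangentDefs`) is
bounded by `C ∑_{p ∈ S} E(U_p)`.

Proof (S. Chatterjee, arXiv:1602.01222, §10, Lemma 10.2, there on a box; here on all of `ℤ⁴` with
both signs of the coordinates):

* energy algebra for unitary `ρ` (sub-namespace `TangentCombPoincare`): `E ≥ 0`, `E(g⁻¹) = E(g)`,
  `E(h g h⁻¹) = E(g)` and the sub-additivity `E(g h) ≤ 2 E(g) + 2 E(h)` — from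
  `‖V − 1‖_F² = 2 (N − Re tr V)` and `‖V W − 1‖_F ≤ ‖V − 1‖_F + ‖W − 1‖_F` for unitary `V, W`
  (Frobenius norm, tree `Matrix.frobenius_norm_sq_eq_re_trace`, `Matrix.frobenius_norm_unitaryGroup_mul`);
* transport (`holonomy_axialFix_of_top`): if all coordinates of `z` above `k` vanish and `j < k`, the
  two `k`-links of the plaquette `q = (z; j, k)` are comb edges, so `Ũ_q = Ũ(z, j) Ũ(z + e_k, j)⁻¹`
  (`CombBasics.axialFix_of_isComb`), while `E(Ũ_q) = E(U_q)` (`CombBasics.plaquetteHolonomyZd_axialFix`);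
  hence each of `E(Ũ(z, j))`, `E(Ũ(z + e_k, j))` is at most `2 E(U_q) +` twice the other;
* induction on the comb depth `∑_{k > j} |x_k|` of the edge `(x, j)`: depth `0` means a comb edge
  (`Ũ = 1`, `E = 0`); otherwise take the largest `k > j` with `x_k ≠ 0` and move one step towards
  the comb tree along `e_k` (plaquette at `x` if `x_k < 0`, at `x − e_k` if `x_k > 0`), which lowers
  the depth by one; the constants assemble as `S ↦ insert q S`, `C ↦ 2 + 2C`.

Reference: S. Chatterjee, arXiv:1602.01222, §§9–10. [arXiv160201222]
-/

noncomputable section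

open scoped Matrix Matrix.Norms.Frobenius
open Literature.Probability.LatticeModels Literature.MathematicalPhysics.QuantumLattice
open Literature.MathematicalPhysics.QuantumFieldTheory

namespace Summit.QuantumFields.YangMills.Theorems.EquipartitionPinsProbe

namespace TangentCombPoincare

/-! ### Energy algebra for a unitary representation -/

section Energy

variable {G : Type} [Group G] {N : ℕ} (ρ : G →* Matrix (Fin N) (Fin N) ℂ)

/-- `‖V − 1‖_F² = 2 (N − Re tr V)` for a unitary `N × N` matrix `V`: `(V − 1)ᴴ (V − 1) = 2 − V − Vᴴ`. [folklore] -/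
theorem norm_sub_one_sq {V : Matrix (Fin N) (Fin N) ℂ} (hV : V ∈ Matrix.unitaryGroup (Fin N) ℂ) :
    ‖V - 1‖ ^ 2 = 2 * ((N : ℝ) - V.trace.re) := by
  have hV' : Vᴴ * V = 1 := by
    have h := Matrix.mem_unitaryGroup_iff'.mp hV
    rwa [Matrix.star_eq_conjTranspose] at h
  have h : (V - 1)ᴴ * (V - 1) = 1 + 1 - V - Vᴴ := by
    rw [Matrix.conjTranspose_sub, Matrix.conjTranspose_one, sub_mul, mul_sub, mul_sub, one_mul,
      mul_one, one_mul, hV']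
    abel
  rw [Matrix.frobenius_norm_sq_eq_re_trace, h, Matrix.trace_sub, Matrix.trace_sub,
    Matrix.trace_add, Matrix.trace_one, Matrix.trace_conjTranspose, Fintype.card_fin]
  simp only [RCLike.re_to_complex, Complex.sub_re, Complex.add_re, Complex.star_def,
    Complex.conj_re, Complex.natCast_re]
  ring

/-- Sub-additivity of the Frobenius distance to `1` under a unitary left factor:
`‖V W − 1‖_F ≤ ‖V − 1‖_F + ‖W − 1‖_F` (`V W − 1 = (V − 1) + V (W − 1)` and `‖V M‖_F = ‖M‖_F`). [folklore] -/
theorem norm_mul_sub_one_le {V : Matrix (Fin N) (Fin N) ℂ} (hV : V ∈ Matrix.unitaryGroup (Fin N) ℂ)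
    (W : Matrix (Fin N) (Fin N) ℂ) : ‖V * W - 1‖ ≤ ‖V - 1‖ + ‖W - 1‖ := by
  have h : V * W - 1 = (V - 1) + V * (W - 1) := by noncomm_ring
  have h2 : ‖V * (W - 1)‖ = ‖W - 1‖ := Matrix.frobenius_norm_unitaryGroup_mul ⟨V, hV⟩ _
  rw [h]
  exact (norm_add_le _ _).trans_eq (by rw [h2])

variable (hρ : ∀ g, ρ g ∈ Matrix.unitaryGroup (Fin N) ℂ)
include hρ

/-- `Re tr ρ(g) ≤ N` for unitary-valued `ρ` (entries of a unitary matrix have modulus `≤ 1`), i.e. the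
energy `N − Re tr ρ(g)` is non-negative. [folklore] -/
theorem re_trace_le (g : G) : (ρ g).trace.re ≤ N :=
  calc (ρ g).trace.re ≤ ‖(ρ g).trace‖ := Complex.re_le_norm _
    _ = ‖∑ k, ρ g k k‖ := rfl
    _ ≤ ∑ k, ‖ρ g k k‖ := norm_sum_le _ _
    _ ≤ ∑ _k : Fin N, (1 : ℝ) := Finset.sum_le_sum fun k _ => entry_norm_bound_of_unitary (hρ g) k k
    _ = N := by simp

/-- For unitary-valued `ρ`: `ρ(g⁻¹) = ρ(g)ᴴ`. [folklore] -/
theorem map_inv_eq_conjTranspose (g : G) : ρ g⁻¹ = (ρ g)ᴴ := by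
  have h1 : ρ g⁻¹ * ρ g = 1 := by rw [← map_mul, inv_mul_cancel, map_one]
  have h2 : ρ g * star (ρ g) = 1 := Matrix.mem_unitaryGroup_iff.mp (hρ g)
  calc ρ g⁻¹ = ρ g⁻¹ * (ρ g * star (ρ g)) := by rw [h2, mul_one]
    _ = (ρ g)ᴴ := by rw [← mul_assoc, h1, one_mul, Matrix.star_eq_conjTranspose]

/-- Inversion invariance of the energy: `Re tr ρ(g⁻¹) = Re tr ρ(g)`. [folklore] -/
theorem re_trace_map_inv (g : G) : (ρ g⁻¹).trace.re = (ρ g).trace.re := by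
  rw [map_inv_eq_conjTranspose ρ hρ, Matrix.trace_conjTranspose]
  simp only [Complex.star_def, Complex.conj_re]

omit hρ in
/-- Conjugation invariance of the energy: `Re tr ρ(h g h⁻¹) = Re tr ρ(g)` (cyclicity of the trace). [folklore] -/
theorem re_trace_map_conj (h g : G) : (ρ (h * g * h⁻¹)).trace.re = (ρ g).trace.re := by
  rw [map_mul, map_mul, Matrix.trace_mul_cycle, ← map_mul, inv_mul_cancel, map_one, one_mul]

/-- **Sub-additivity of the energy**: `E(g h) ≤ 2 E(g) + 2 E(h)` for `E(g) = N − Re tr ρ(g) = ½‖ρ(g) − 1‖_F²`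
and unitary-valued `ρ` (`‖ρ(g)ρ(h) − 1‖ ≤ ‖ρ(g) − 1‖ + ‖ρ(h) − 1‖` and `(a + b)² ≤ 2a² + 2b²`). [folklore] -/
theorem energy_mul_le (g h : G) :
    (N : ℝ) - (ρ (g * h)).trace.re ≤
      2 * ((N : ℝ) - (ρ g).trace.re) + 2 * ((N : ℝ) - (ρ h).trace.re) := by
  have hg := norm_sub_one_sq (hρ g)
  have hh := norm_sub_one_sq (hρ h)
  have hgh := norm_sub_one_sq (hρ (g * h))
  have hle : ‖ρ (g * h) - 1‖ ≤ ‖ρ g - 1‖ + ‖ρ h - 1‖ := by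
    rw [map_mul]; exact norm_mul_sub_one_le (hρ g) (ρ h)
  have hsq : ‖ρ (g * h) - 1‖ ^ 2 ≤ (‖ρ g - 1‖ + ‖ρ h - 1‖) ^ 2 :=
    pow_le_pow_left₀ (norm_nonneg _) hle 2
  nlinarith [sq_nonneg (‖ρ g - 1‖ - ‖ρ h - 1‖)]

end Energy

/-! ### Transport across one plaquette towards the comb tree -/

section Transport

variable {G : Type} [Group G] {N : ℕ} (ρ : G →* Matrix (Fin N) (Fin N) ℂ)
  (hρ : ∀ g, ρ g ∈ Matrix.unitaryGroup (Fin N) ℂ)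

/-- If all coordinates of `z` above `k` vanish and `j < k`, the two `k`-links `(z, k)`, `(z + e_j, k)` of the
plaquette `(z; j, k)` are comb edges, so its gauge-fixed holonomy is `Ũ(z, j) Ũ(z + e_k, j)⁻¹`. [folklore] -/
theorem holonomy_axialFix_of_top (U : LGConfig 4 G) {z : Site 4} {j k : Fin 4} (hjk : j < k)
    (hz : ∀ k' : Fin 4, k < k' → z k' = 0) :
    plaquetteHolonomyZd (axialFix U) z j k = axialFix U (z, j) * (axialFix U (z + Pi.single k 1, j))⁻¹ := by
  have h1 : axialFix U (z, k) = 1 := CombBasics.axialFix_of_isComb U hz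
  have h2 : axialFix U (z + Pi.single j 1, k) = 1 :=
    CombBasics.axialFix_of_isComb U fun k' hk' => by
      rw [Pi.add_apply, hz k' hk', Pi.single_eq_of_ne (hjk.trans hk').ne' _, add_zero]
  rw [plaquetteHolonomyZd, h1, h2, mul_one, inv_one, mul_one]

include hρ in
/-- **One transport step**: under the hypotheses of `holonomy_axialFix_of_top`, each of the energies of
`Ũ(z, j)` and `Ũ(z + e_k, j)` is at most `2 E(U_{(z;j,k)})` plus twice the other
(`Ũ(z, j) = Ũ_q Ũ(z + e_k, j)`, `Ũ(z + e_k, j) = Ũ_q⁻¹ Ũ(z, j)`, `E(Ũ_q) = E(U_q)`). [folklore] -/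
theorem energy_transport (U : LGConfig 4 G) {z : Site 4} {j k : Fin 4} (hjk : j < k)
    (hz : ∀ k' : Fin 4, k < k' → z k' = 0) :
    ((N : ℝ) - (ρ (axialFix U (z, j))).trace.re ≤
        2 * ((N : ℝ) - (ρ (plaquetteHolonomyZd U z j k)).trace.re) +
          2 * ((N : ℝ) - (ρ (axialFix U (z + Pi.single k 1, j))).trace.re)) ∧
      ((N : ℝ) - (ρ (axialFix U (z + Pi.single k 1, j))).trace.re ≤
        2 * ((N : ℝ) - (ρ (plaquetteHolonomyZd U z j k)).trace.re) +
          2 * ((N : ℝ) - (ρ (axialFix U (z, j))).trace.re)) := by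
  have hq := holonomy_axialFix_of_top U hjk hz
  have hE : (ρ (plaquetteHolonomyZd (axialFix U) z j k)).trace.re =
      (ρ (plaquetteHolonomyZd U z j k)).trace.re := by
    rw [CombBasics.plaquetteHolonomyZd_axialFix, re_trace_map_conj ρ]
  constructor
  · have h : axialFix U (z, j) =
        plaquetteHolonomyZd (axialFix U) z j k * axialFix U (z + Pi.single k 1, j) := by
      rw [hq, inv_mul_cancel_right]
    rw [h]
    refine (energy_mul_le ρ hρ _ _).trans_eq ?_
    rw [hE]
  · have h : axialFix U (z + Pi.single k 1, j) =
        (plaquetteHolonomyZd (axialFix U) z j k)⁻¹ * axialFix U (z, j) := by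
      rw [hq, mul_inv_rev, inv_inv, inv_mul_cancel_right]
    rw [h]
    refine (energy_mul_le ρ hρ _ _).trans_eq ?_
    rw [re_trace_map_inv ρ hρ, hE]

include hρ in
/-- **Assembly of the constants**: a transport bound `E(Ũ(x, j)) ≤ 2 E(U_q) + 2 E(Ũ(y, j))` and a comb
bound for `(y, j)` with data `(S, C)` give a comb bound for `(x, j)` with data `(insert q S, 2 + 2C)`
(all energies are non-negative). [folklore] -/
theorem assemble {x y : Site 4} {j : Fin 4} (q : ZdPlaquette 4)
    (hkey : ∀ U : LGConfig 4 G, (N : ℝ) - (ρ (axialFix U (x, j))).trace.re ≤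
      2 * ((N : ℝ) - (ρ (plaquetteHolonomyZd U q.1 q.2.1.1 q.2.1.2)).trace.re) +
        2 * ((N : ℝ) - (ρ (axialFix U (y, j))).trace.re))
    (ih : ∃ (S : Finset (ZdPlaquette 4)) (C : ℝ), 0 ≤ C ∧ ∀ U : LGConfig 4 G,
      (N : ℝ) - (ρ (axialFix U (y, j))).trace.re ≤
        C * ∑ p ∈ S, ((N : ℝ) - (ρ (plaquetteHolonomyZd U p.1 p.2.1.1 p.2.1.2)).trace.re)) :
    ∃ (S : Finset (ZdPlaquette 4)) (C : ℝ), 0 ≤ C ∧ ∀ U : LGConfig 4 G,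
      (N : ℝ) - (ρ (axialFix U (x, j))).trace.re ≤
        C * ∑ p ∈ S, ((N : ℝ) - (ρ (plaquetteHolonomyZd U p.1 p.2.1.1 p.2.1.2)).trace.re) := by
  obtain ⟨S, C, hC, hS⟩ := ih
  refine ⟨insert q S, 2 + 2 * C, by positivity, fun U => ?_⟩
  have hnn : ∀ p ∈ insert q S,
      0 ≤ (N : ℝ) - (ρ (plaquetteHolonomyZd U p.1 p.2.1.1 p.2.1.2)).trace.re := fun p _ =>
    sub_nonneg.2 (re_trace_le ρ hρ _)
  have h1 : (N : ℝ) - (ρ (plaquetteHolonomyZd U q.1 q.2.1.1 q.2.1.2)).trace.re ≤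
      ∑ p ∈ insert q S, ((N : ℝ) - (ρ (plaquetteHolonomyZd U p.1 p.2.1.1 p.2.1.2)).trace.re) :=
    Finset.single_le_sum
      (f := fun p : ZdPlaquette 4 => (N : ℝ) - (ρ (plaquetteHolonomyZd U p.1 p.2.1.1 p.2.1.2)).trace.re)
      hnn (Finset.mem_insert_self q S)
  have h2 : ∑ p ∈ S, ((N : ℝ) - (ρ (plaquetteHolonomyZd U p.1 p.2.1.1 p.2.1.2)).trace.re) ≤
      ∑ p ∈ insert q S, ((N : ℝ) - (ρ (plaquetteHolonomyZd U p.1 p.2.1.1 p.2.1.2)).trace.re) :=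
    Finset.sum_le_sum_of_subset_of_nonneg (Finset.subset_insert q S) fun p hp _ => hnn p hp
  have h3 := mul_le_mul_of_nonneg_left h2 hC
  linarith [hkey U, hS U]

end Transport

/-! ### The comb depth of an edge and the induction -/

section Depth

/-- The comb depth `∑_{k > j} |x_k|` of the edge `(x, j)` vanishes iff `(x, j)` is a comb edge. [folklore] -/
theorem sum_natAbs_eq_zero_iff (x : Site 4) (j : Fin 4) :
    ∑ k ∈ Finset.Ioi j, (x k).natAbs = 0 ↔ ∀ k : Fin 4, j < k → x k = 0 := by
  rw [Finset.sum_eq_zero_iff]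
  simp only [Finset.mem_Ioi, Int.natAbs_eq_zero]

/-- An edge of positive comb depth has a largest direction `k > j` with `x_k ≠ 0`. [folklore] -/
theorem exists_top (x : Site 4) (j : Fin 4) (h : ∑ k ∈ Finset.Ioi j, (x k).natAbs ≠ 0) :
    ∃ k : Fin 4, j < k ∧ x k ≠ 0 ∧ ∀ k' : Fin 4, k < k' → x k' = 0 := by
  classical
  obtain ⟨k₀, hk₀, hx₀⟩ := Finset.exists_ne_zero_of_sum_ne_zero h
  set T : Finset (Fin 4) := (Finset.Ioi j).filter fun k => x k ≠ 0 with hT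
  have hne : T.Nonempty := ⟨k₀, Finset.mem_filter.2 ⟨hk₀, Int.natAbs_ne_zero.1 hx₀⟩⟩
  have hmem := Finset.mem_filter.1 (T.max'_mem hne)
  refine ⟨T.max' hne, Finset.mem_Ioi.1 hmem.1, hmem.2, fun k' hk' => ?_⟩
  by_contra hx'
  exact absurd (T.le_max' k' (Finset.mem_filter.2 ⟨Finset.mem_Ioi.2 ((Finset.mem_Ioi.1 hmem.1).trans hk'), hx'⟩))
    (not_le.2 hk')

/-- Moving the base point along `e_k`, `k > j`, changes the comb depth of `(x, j)` only through `|x_k|`. [folklore] -/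
theorem sum_natAbs_add_single (x : Site 4) {j k : Fin 4} (hjk : j < k) (c : ℤ) :
    ∑ k' ∈ Finset.Ioi j, ((x + Pi.single k c : Site 4) k').natAbs + (x k).natAbs =
      ∑ k' ∈ Finset.Ioi j, (x k').natAbs + (x k + c).natAbs := by
  have hk : k ∈ Finset.Ioi j := Finset.mem_Ioi.2 hjk
  rw [← Finset.add_sum_erase _ _ hk, ← Finset.add_sum_erase _ (fun k' => (x k').natAbs) hk]
  have hrest : ∑ k' ∈ (Finset.Ioi j).erase k, ((x + Pi.single k c : Site 4) k').natAbs =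
      ∑ k' ∈ (Finset.Ioi j).erase k, (x k').natAbs :=
    Finset.sum_congr rfl fun k' hk' => by
      rw [Pi.add_apply, Pi.single_eq_of_ne (Finset.ne_of_mem_erase hk'), add_zero]
  rw [hrest, Pi.add_apply, Pi.single_eq_same]
  ring

end Depth

section Induction

variable {G : Type} [Group G] {N : ℕ} (ρ : G →* Matrix (Fin N) (Fin N) ℂ)
  (hρ : ∀ g, ρ g ∈ Matrix.unitaryGroup (Fin N) ℂ)
include hρ

/-- **The comb-gauge Poincaré inequality by induction on the comb depth** `n = ∑_{k > j} |x_k|` of the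
edge `(x, j)`. [folklore] -/
theorem comb_bound : ∀ (n : ℕ) (x : Site 4) (j : Fin 4), ∑ k ∈ Finset.Ioi j, (x k).natAbs = n →
    ∃ (S : Finset (ZdPlaquette 4)) (C : ℝ), 0 ≤ C ∧ ∀ U : LGConfig 4 G,
      (N : ℝ) - (ρ (axialFix U (x, j))).trace.re ≤
        C * ∑ p ∈ S, ((N : ℝ) - (ρ (plaquetteHolonomyZd U p.1 p.2.1.1 p.2.1.2)).trace.re) := by
  intro n
  induction n with
  | zero =>
    intro x j h0
    refine ⟨∅, 0, le_rfl, fun U => ?_⟩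
    rw [CombBasics.axialFix_of_isComb U ((sum_natAbs_eq_zero_iff x j).1 h0), map_one]
    simp
  | succ n ih =>
    intro x j hx
    obtain ⟨k, hjk, hxk, htop⟩ := exists_top x j (by omega)
    rcases lt_or_gt_of_ne hxk with hneg | hpos
    · -- `x_k < 0`: the plaquette at `x`, next base point `x + e_k`
      have hy : ∑ k' ∈ Finset.Ioi j, ((x + Pi.single k 1 : Site 4) k').natAbs = n := by
        have h := sum_natAbs_add_single x hjk 1
        omega
      exact assemble ρ hρ (x, ⟨(j, k), hjk⟩) (fun U => (energy_transport ρ hρ U hjk htop).1) (ih _ j hy)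
    · -- `x_k > 0`: the plaquette at `x - e_k`, next base point `x - e_k`
      have htop' : ∀ k' : Fin 4, k < k' → (x - Pi.single k 1 : Site 4) k' = 0 := fun k' hk' => by
        rw [Pi.sub_apply, htop k' hk', Pi.single_eq_of_ne hk'.ne' _, sub_zero]
      have hy : ∑ k' ∈ Finset.Ioi j, ((x - Pi.single k 1 : Site 4) k').natAbs = n := by
        have h := sum_natAbs_add_single x hjk (-1)
        rw [← CombBasics.sub_single] at h
        omega
      have key := fun U : LGConfig 4 G => (energy_transport ρ hρ U hjk htop').2
      simp only [sub_add_cancel] at key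
      exact assemble ρ hρ (x - Pi.single k 1, ⟨(j, k), hjk⟩) key (ih _ j hy)

end Induction

end TangentCombPoincare

/-- STUB TC2 of line `Sketch` (crux `stmt-QuantumFields-8760`) — **comb-gauge Poincaré inequality on `ℤ⁴`**:
for a unitary-valued representation `ρ` and every edge `e`, there are finitely many plaquettes `S` and
`C ≥ 0` with `N − Re tr ρ(Ũ_e) ≤ C ∑_{p ∈ S} (N − Re tr ρ(U_p))` for every configuration `U`, where
`Ũ = axialFix U` is the complete axial gauge (Chatterjee, arXiv:1602.01222, Lemma 10.2, here on all of
`ℤ⁴`). [cite: arXiv160201222, Lemma 10.2] -/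
theorem stub_combPoincare :
    ∀ (G : Type) [Group G] {N : ℕ} (ρ : G →* Matrix (Fin N) (Fin N) ℂ),
      (∀ g, ρ g ∈ Matrix.unitaryGroup (Fin N) ℂ) →
      ∀ e : Literature.MathematicalPhysics.QuantumLattice.ZdEdge 4, ∃ (S : Finset (Literature.MathematicalPhysics.QuantumLattice.ZdPlaquette 4)) (C : ℝ), 0 ≤ C ∧
        ∀ U : Literature.MathematicalPhysics.QuantumLattice.LGConfig 4 G,
          (N : ℝ) - (ρ (Summit.QuantumFields.YangMills.Theorems.EquipartitionPinsProbe.axialFix U e)).trace.re ≤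
            C * ∑ p ∈ S, ((N : ℝ) - (ρ (Literature.MathematicalPhysics.QuantumLattice.plaquetteHolonomyZd U p.1 p.2.1.1 p.2.1.2)).trace.re) := by
  intro G _ N ρ hρ e
  obtain ⟨x, j⟩ := e
  exact TangentCombPoincare.comb_bound ρ hρ _ x j rfl

end Summit.QuantumFields.YangMills.Theorems.EquipartitionPinsProbe

end
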